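import Literature.MathematicalPhysics.QuantumFieldTheory.ConformalBootstrap3D.PointKernelK34L515.L22C0
import Literature.MathematicalPhysics.QuantumFieldTheory.ConformalBootstrap3D.PointKernelK34L515.L22C1
import Literature.MathematicalPhysics.QuantumFieldTheory.ConformalBootstrap3D.PointKernelLowerV3

/-!
# K34L515 — assembly of the lower-box certificate, conditional on the mono rows (typer-g8)

`boxExcluded_K34L515_of_rows` (file `AssemblyL515`): the exclusion of the box `Δσ ∈ [103/200, 13/25]`,
`Δε ∈ [3/5, 19/20)` (single correlator, `F_-` sum rule) follows by `PCert.boxExcluded_of_kernelV3M` from the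
LANDED kernel facts of the certificate `certL515` — node checks (`Cert`), the identity pieces `hIrowL515`
(`IdentityL515`), rule (T) from `E_T = 100` (`Tail100`), the 179 head cells and 6 `ε` cells (`Eps*`, `L*C*`
finals of the Taylor-model kernel v3; one file `AsmRowL515*` per row: the greedy cover of the row by its landed
cells, the top-anchored last cell restricted to the uncovered remainder) — and ONE remaining hypothesis
`RowsL515`: termwise positivity of the `(j, E)` mono terms for `E ∈ [max 24 (j + 19/32), 100]`,
`j + 19/32 < 100`, which the mono cells `M<j>C<k>` (`PointKernelMono`, `PCert.monoRow_of_cells`) discharge row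
by row (even `j` with the landed kernel; odd `j` with its odd-spin extension).  Generated by `gen/mk_assembly.py`
(HOME/code/typer-g8).

(This file: row 22, 2 cells.)
-/

set_option maxRecDepth 100000
set_option maxHeartbeats 0
set_option Elab.async false

namespace Literature.MathematicalPhysics.QuantumFieldTheory.ConformalBootstrap3D.PointKernelK34L515

open Set Literature.MathematicalPhysics.QuantumFieldTheory.ConformalBootstrap3D Literature.MathematicalPhysics.QuantumFieldTheory.ConformalBootstrap3D.PointKernel Literature.MathematicalPhysics.QuantumFieldTheory.ConformalBootstrap3D.PointKernel.PCert
open Literature.Analysis.ValidatedNumerics.NumericsMP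

/-- breakpoints of the greedy cover of head row ℓ = 22 by its landed cells. [folklore] -/
noncomputable def tRowL515H22 : ℕ → ℝ
  | 0 => (23 : ℝ)
  | 1 => ((47 : ℝ) / 2)
  | 2 => (24 : ℝ)
  | _ => 0

/-- the 2 cells of head row ℓ = 22 as `V3Block` facts on consecutive breakpoints. [cite: HogervorstRychkov2013, §3 eq. (3.6)] -/
theorem hcellRowL515H22 : ∀ k < 2, certL515.V3Block (((24 : ℚ)) : ℝ) ((((19 : ℚ) / 32) : ℚ) : ℝ) (tRowL515H22 k) (tRowL515H22 (k + 1)) 22 := by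
  intro k hk
  interval_cases k <;> simp only [tRowL515H22]
  · intro Q hQ htail q hq Δ hΔ
    exact l22c0_block hQ (by intro j E hE hj hjE; exact htail j E (by exact_mod_cast hE) (by push_cast at hj ⊢; exact hj) hjE) q hq Δ ⟨le_trans (by norm_num) hΔ.1, lt_of_lt_of_le hΔ.2 (by norm_num)⟩
  · intro Q hQ htail q hq Δ hΔ
    exact l22c1_block hQ (by intro j E hE hj hjE; exact htail j E (by exact_mod_cast hE) (by push_cast at hj ⊢; exact hj) hjE) q hq Δ ⟨le_trans (by norm_num) hΔ.1, lt_of_lt_of_le hΔ.2 (by norm_num)⟩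

end Literature.MathematicalPhysics.QuantumFieldTheory.ConformalBootstrap3D.PointKernelK34L515
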